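/-
Copyright (c) 2026. All rights reserved.
Released under Apache 2.0 license as described in the file LICENSE.
-/
import Summits.Schanuel.Schanuel.Theorems.ZilberEacRealFibreZeros
import Summits.Schanuel.Schanuel.Theorems.ZilberEacSequenceRelation
import Literature.NumberTheory.Transcendental.ExpVarietiesDimension
import Literature.ModelTheory.Zilber.EACCyclicCoverBases
import HarnessLib

/-!
# Real-slope line × arbitrary plane curve III: Zariski density of the exponential points

HONEST FRAMING.  Third file of the series (cell `pub-schanuel`, seat 1, gen 11).  We answer
Mantova–Masser's "unprojected density" question (D. Masser, V. Mantova, *Polynomial-exponential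
equations — some new cases of solvability*, PLMS 129 (2024), arXiv:2303.05592, p. 5: OPEN in
general) on ONE MORE EXPLICIT FAMILY of surfaces in `ℂ² × ℂ²`:

  `W(a, b; P) = {x₁ = a x₀ + b} × Z(P)`, `a ∈ ℝ ∖ ℚ`, `b ∈ ℂ`, `P ∈ ℂ[y₀, y₁]` irreducible with a
  zero in `(ℂˣ)²` — the fibre curve is ARBITRARY (not a graph, singularities allowed).

`unprojectedDense_lineCurveSurface`: the exponential points `(z, az+b, e^z, e^{az+b})`,
`P(e^z, e^{az+b}) = 0`, are Zariski dense in `W`.  Earlier files of the cell covered graph fibres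
`y₀ = q(y₁)` (`ZilberEacDensityRealSlope`, `ZilberEacRealLineDensity`) and polynomially
parametrised fibres `(q₀(t), q₁(t))` (`ZilberEacRealLineParam`, seat 2); here the fibre is ANY
irreducible plane curve, e.g. a smooth cubic (positive genus, no polynomial parametrisation).
This is a modest rung in the case ladder of Zilber's Exponential-Algebraic Closedness conjecture;
it is NOT Schanuel's conjecture (neither used nor implied; EAC ⇏ SC), `EC(3,2)` stays OPEN, and so
does the density question for non-real slopes `a ∈ ℂ ∖ ℝ` with non-graph fibres and for all
non-split surfaces.

Proof.  `ZilberEacRealFibreZeros.exists_rf_accumulation_family` gives infinitely many bounded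
torus points `c_i ∈ Z(P)`, each the limit of fibre points of exponential points escaping to
infinity in the base.  The DIAGONAL LEMMA (`unprojectedDense_of_tendsto_family`, Part A) merges
these sequences into one sequence with infinitely many cluster values of a fibre coordinate, to
which the cell's relation theorem `unprojectedDense_of_not_clusterIn` (seat 2, Theorem G′/H:
growth in `x_{j₀}` versus boundedness of `y_{j₀}` on a surface) applies.  Part B certifies
`W` (irreducible closed of dimension `2`, as `Z(θ⁻¹(P̃))` for the surjective substitution
`θ : ℂ[x, y] → ℂ[t, y₀, y₁]`, `x₀ ↦ t`, `x₁ ↦ a t + b`).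
-/

noncomputable section

open Filter Topology Metric Set Complex Bornology MvPolynomial
open Literature.NumberTheory.Transcendental Literature.ModelTheory.Zilber
open Literature.ModelTheory.ExponentialFields

set_option linter.dupNamespace false

namespace Summit.Schanuel.Schanuel.Theorems

/-! ## Part A. The diagonal lemma -/

section Diagonal

variable {n : ℕ}

/-- An injective sequence in `ℂ²` has infinitely many distinct values in some coordinate. -/
theorem rf_exists_coord_range_infinite {c : ℕ → Fin 2 → ℂ} (hc : Function.Injective c) :
    ∃ j : Fin 2, (Set.range fun i => c i j).Infinite := by
  by_contra h
  simp only [not_exists, Set.not_infinite] at h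
  have hfin : (Set.univ.pi fun j : Fin 2 => Set.range fun i => c i j).Finite :=
    Set.Finite.pi fun j => h j
  refine Set.infinite_range_of_injective hc (hfin.subset ?_)
  rintro _ ⟨i, rfl⟩
  exact fun j _ => ⟨i, rfl⟩

/-- **Diagonal lemma.** On an irreducible surface `S ⊆ ℂⁿ × ℂⁿ` suppose that for every `i ∈ ℕ`
there is a sequence of points of `S ∩ Γ_exp` whose `x_{j₀}`-coordinate tends to infinity and whose
`y_{j₀}`-coordinate tends to `w_i`, where the `w_i` are bounded and take infinitely many values.
Then the exponential points of `S` are Zariski dense.  (A diagonal sequence has every `w_i` as a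
cluster value, so it clusters in no finite set; conclude by `unprojectedDense_of_not_clusterIn`.)
(new) -/
theorem unprojectedDense_of_tendsto_family {S : Set (Fin n ⊕ Fin n → ℂ)}
    (hS : IsIrreducibleClosed ℂ S) (hdim : zariskiDim ℂ S ≤ (2 : ℕ)) (j₀ : Fin n)
    (q : ℕ → ℕ → Fin n ⊕ Fin n → ℂ) (hqS : ∀ i k, q i k ∈ S)
    (hqΓ : ∀ i k, q i k ∈ expGraph ℂ n)
    (hx : ∀ i, Tendsto (fun k => ‖q i k (Sum.inl j₀)‖) atTop atTop) (w : ℕ → ℂ)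
    (hw : ∀ i, Tendsto (fun k => q i k (Sum.inr j₀)) atTop (𝓝 (w i))) {B : ℝ}
    (hB : ∀ i, ‖w i‖ ≤ B) (hinf : (Set.range w).Infinite) : UnprojectedDense S := by
  have hk : ∀ i m : ℕ, ∃ k, (m : ℝ) ≤ ‖q i k (Sum.inl j₀)‖ ∧
      ‖q i k (Sum.inr j₀) - w i‖ < 1 / ((m : ℝ) + 1) := by
    intro i m
    have h1 := (hx i).eventually_ge_atTop (m : ℝ)
    have h2 : ∀ᶠ k in atTop, ‖q i k (Sum.inr j₀) - w i‖ < 1 / ((m : ℝ) + 1) :=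
      (tendsto_iff_norm_sub_tendsto_zero.1 (hw i)).eventually_lt_const Nat.one_div_pos_of_nat
    exact (h1.and h2).exists
  choose k hk₁ hk₂ using hk
  have h1le : ∀ m : ℕ, 1 / ((m : ℝ) + 1) ≤ 1 := fun m => by
    rw [div_le_one (by positivity)]; linarith [(Nat.cast_nonneg m : (0 : ℝ) ≤ m)]
  refine unprojectedDense_of_not_clusterIn hS hdim j₀
    (p := fun m => q (Nat.unpair m).1 (k (Nat.unpair m).1 m)) (fun m => hqS _ _)
    (fun m => hqΓ _ _) ?_ (B := B + 1) ?_ ?_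
  · exact tendsto_atTop_mono (fun m => hk₁ (Nat.unpair m).1 m) tendsto_natCast_atTop_atTop
  · intro m
    have e1 := hk₂ (Nat.unpair m).1 m
    have e2 := hB (Nat.unpair m).1
    have e3 := norm_add_le (q (Nat.unpair m).1 (k (Nat.unpair m).1 m) (Sum.inr j₀) -
      w (Nat.unpair m).1) (w (Nat.unpair m).1)
    rw [sub_add_cancel] at e3
    linarith [h1le m]
  · intro Z hZ
    have hwZ : ∀ i, w i ∈ Z := fun i => by
      refine hZ (fun t => Nat.pair i t) (fun t₁ t₂ h => Nat.pair_lt_pair_right i h) (w i) ?_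
      have e : ((fun m => q (Nat.unpair m).1 (k (Nat.unpair m).1 m) (Sum.inr j₀)) ∘
          fun t => Nat.pair i t) = fun t => q i (k i (Nat.pair i t)) (Sum.inr j₀) := by
        funext t; simp [Nat.unpair_pair]
      rw [e]
      refine tendsto_iff_norm_sub_tendsto_zero.2 (squeeze_zero (fun t => norm_nonneg _)
        (fun t => (hk₂ i _).le.trans (one_div_le_one_div_of_le (by positivity)
          (by exact_mod_cast Nat.add_le_add_right (Nat.right_le_pair i t) 1)))
        tendsto_one_div_add_atTop_nhds_zero_nat)
    exact hinf (Z.finite_toSet.subset (by rintro _ ⟨i, rfl⟩; exact Finset.mem_coe.2 (hwZ i)))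

end Diagonal

/-! ## Part B. The surfaces `{x₁ = a x₀ + b} × Z(P)` and their exponential points -/

section Surface

variable (a : ℝ) (b : ℂ)

/-- The split surface `W(a, b; P) = {x₁ = a x₀ + b} × Z(P) ⊆ ℂ² × ℂ²`. (new) -/
def lineCurveSurface (P : MvPolynomial (Fin 2) ℂ) : Set (Fin 2 ⊕ Fin 2 → ℂ) :=
  {w | w (Sum.inl 1) = (a : ℂ) * w (Sum.inl 0) + b ∧
    MvPolynomial.eval (fun i => w (Sum.inr i)) P = 0}

/-- The point `(z, az + b; e^z, e^{az+b})` of `Γ_exp` over the base line. (new) -/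
def rfLinePt (z : ℂ) : Fin 2 ⊕ Fin 2 → ℂ := Sum.elim ![z, (a : ℂ) * z + b] (rfPt a b 1 z)

/-- Base coordinate `x₀` of `rfLinePt`. -/
@[simp] theorem rfLinePt_inl_zero (z : ℂ) : rfLinePt a b z (Sum.inl 0) = z := by simp [rfLinePt]

/-- Base coordinate `x₁ = a x₀ + b` of `rfLinePt`. -/
@[simp] theorem rfLinePt_inl_one (z : ℂ) : rfLinePt a b z (Sum.inl 1) = (a : ℂ) * z + b := by
  simp [rfLinePt]

/-- Fibre coordinates of `rfLinePt` are the twisted point `rfPt a b 1 z`. -/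
@[simp] theorem rfLinePt_inr (z : ℂ) (i : Fin 2) : rfLinePt a b z (Sum.inr i) = rfPt a b 1 z i := by
  simp [rfLinePt]

/-- `rfLinePt z ∈ Γ_exp`. -/
theorem rfLinePt_mem_expGraph (z : ℂ) : rfLinePt a b z ∈ expGraph ℂ 2 := by
  rw [mem_expGraph_iff]
  intro i
  fin_cases i
  · simp [rfPt]
  · simp [rfPt]

/-- `rfLinePt z ∈ W` iff `Φ_1(z) = P(e^z, e^{az+b}) = 0`. -/
theorem rfLinePt_mem_lineCurveSurface_iff (P : MvPolynomial (Fin 2) ℂ) (z : ℂ) :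
    rfLinePt a b z ∈ lineCurveSurface a b P ↔ curveFn a b P 1 z = 0 := by
  simp only [lineCurveSurface, Set.mem_setOf_eq, rfLinePt_inl_one, rfLinePt_inl_zero, true_and]
  exact Iff.rfl

/-- Torus points of `W` ↔ torus zeros of `P`. -/
theorem lineCurveSurface_inter_torusLocus_nonempty_iff (P : MvPolynomial (Fin 2) ℂ) :
    (lineCurveSurface a b P ∩ torusLocus ℂ 2).Nonempty ↔
      ∃ c : Fin 2 → ℂ, c 0 ≠ 0 ∧ c 1 ≠ 0 ∧ MvPolynomial.eval c P = 0 := by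
  constructor
  · rintro ⟨w, hwS, hwT⟩
    exact ⟨fun i => w (Sum.inr i), hwT 0, hwT 1, hwS.2⟩
  · rintro ⟨c, h0, h1, hc⟩
    refine ⟨Sum.elim ![0, b] c, ⟨by simp, ?_⟩, fun i => ?_⟩
    · simpa using hc
    · fin_cases i
      · simpa using h0
      · simpa using h1

/-- **Density, structural form** (`a ∈ ℝ ∖ ℚ`, `P ≠ 0`): if `W(a, b; P)` is an irreducible closed
set of dimension `≤ 2` with a torus point, its exponential points are Zariski dense. (new) -/
theorem unprojectedDense_lineCurveSurface_of_isIrreducibleClosed {a : ℝ} (ha : Irrational a)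
    (b : ℂ) {P : MvPolynomial (Fin 2) ℂ} (hP : P ≠ 0)
    (hS : IsIrreducibleClosed ℂ (lineCurveSurface a b P))
    (hdim : zariskiDim ℂ (lineCurveSurface a b P) ≤ (2 : ℕ))
    (hW : (lineCurveSurface a b P ∩ torusLocus ℂ 2).Nonempty) :
    UnprojectedDense (lineCurveSurface a b P) := by
  obtain ⟨c, B, hcinj, hcB, hacc⟩ := exists_rf_accumulation_family ha b hP
    ((lineCurveSurface_inter_torusLocus_nonempty_iff a b P).1 hW)
  choose z hz0 hzinf hzlim using hacc
  obtain ⟨j₀, hj₀⟩ := rf_exists_coord_range_infinite hcinj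
  refine unprojectedDense_of_tendsto_family hS hdim j₀ (fun i k => rfLinePt a b (z i k))
    (fun i k => (rfLinePt_mem_lineCurveSurface_iff a b P _).2 (hz0 i k))
    (fun i k => rfLinePt_mem_expGraph a b _) ?_ (fun i => c i j₀) ?_ (B := B) (fun i => hcB i j₀)
    hj₀
  · intro i
    fin_cases j₀
    · simpa using hzinf i
    · have ha0 : (0 : ℝ) < |a| := abs_pos.2 ha.ne_zero
      have hlow : ∀ k, |a| * ‖z i k‖ + -‖b‖ ≤ ‖(a : ℂ) * z i k + b‖ := fun k => by
        have h1 := norm_sub_le ((a : ℂ) * z i k + b) b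
        rw [add_sub_cancel_right, norm_mul, Complex.norm_real, Real.norm_eq_abs] at h1
        linarith
      have hlim : Tendsto (fun k => |a| * ‖z i k‖ + -‖b‖) atTop atTop :=
        tendsto_atTop_add_const_right _ _ ((hzinf i).const_mul_atTop ha0)
      simpa using tendsto_atTop_mono hlow hlim
  · intro i
    have e : (fun k => rfLinePt a b (z i k) (Sum.inr j₀)) =
        ((fun p : Fin 2 → ℂ => p j₀) ∘ fun k => rfPt a b 1 (z i k)) := by
      funext k; simp
    rw [e]
    exact ((continuous_apply j₀).tendsto (c i)).comp (hzlim i)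

end Surface

/-! ## Part C. The certificate: `W(a, b; P)` is an irreducible surface for irreducible `P` -/

section Certificate

variable (a : ℝ) (b : ℂ)

/-- The substitution `θ : ℂ[x₀, x₁, y₀, y₁] → ℂ[t, y₀, y₁]`, `x₀ ↦ t`, `x₁ ↦ a t + b`,
`yᵢ ↦ yᵢ`. (new) -/
def lcSubst : Fin 2 ⊕ Fin 2 → MvPolynomial (Fin 3) ℂ :=
  Sum.elim ![X 0, C (a : ℂ) * X 0 + C b] (fun i => X (Fin.succ i))

/-- The parameter point `(w(x₀), w(y₀), w(y₁)) ∈ ℂ³` of `w`. -/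
def lcPt (w : Fin 2 ⊕ Fin 2 → ℂ) : Fin 3 → ℂ := Fin.cases (w (Sum.inl 0)) (fun i => w (Sum.inr i))

/-- `θ` followed by evaluation at the parameter point of `w ∈ {x₁ = a x₀ + b} × ℂ²` is evaluation
at `w`, on variables. -/
theorem eval_lcPt_lcSubst {w : Fin 2 ⊕ Fin 2 → ℂ} (hw : w (Sum.inl 1) = (a : ℂ) * w (Sum.inl 0) + b)
    (v : Fin 2 ⊕ Fin 2) : eval (lcPt w) (lcSubst a b v) = w v := by
  rcases v with i | i
  · fin_cases i
    · simp [lcSubst, lcPt]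
    · simp [lcSubst, lcPt, hw]
  · simp [lcSubst, lcPt]

/-- `θ` followed by evaluation at the parameter point of `w ∈ {x₁ = a x₀ + b} × ℂ²` is evaluation
at `w`. -/
theorem eval_lcPt_aeval_lcSubst {w : Fin 2 ⊕ Fin 2 → ℂ}
    (hw : w (Sum.inl 1) = (a : ℂ) * w (Sum.inl 0) + b) (p : MvPolynomial (Fin 2 ⊕ Fin 2) ℂ) :
    eval (lcPt w) (aeval (lcSubst a b) p) = aeval w p := by
  have h : (fun v => eval (lcPt w) (lcSubst a b v)) = w := funext (eval_lcPt_lcSubst a b hw)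
  rw [eval_aeval_eq_aeval, h]

/-- `θ` is onto (`t ↦ x₀`, `yᵢ ↦ yᵢ` is a section). -/
theorem lcSubst_surjective : Function.Surjective
    (aeval (lcSubst a b) : MvPolynomial (Fin 2 ⊕ Fin 2) ℂ →ₐ[ℂ] MvPolynomial (Fin 3) ℂ) := by
  intro r
  let back : Fin 3 → Fin 2 ⊕ Fin 2 := Fin.cases (Sum.inl 0) (fun i => Sum.inr i)
  refine ⟨rename back r, ?_⟩
  rw [aeval_rename]
  have hX : (lcSubst a b ∘ back) = X := by
    funext j
    refine Fin.cases ?_ (fun i => ?_) j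
    · simp [back, lcSubst]
    · simp [back, lcSubst]
  rw [hX, aeval_X_left_apply]

/-- The prime ideal `θ⁻¹((P̃))`, `P̃ = P(y₀, y₁) ∈ ℂ[t, y₀, y₁]`. (new) -/
def lcIdeal (P : MvPolynomial (Fin 2) ℂ) : Ideal (MvPolynomial (Fin 2 ⊕ Fin 2) ℂ) :=
  Ideal.comap (aeval (lcSubst a b) : MvPolynomial (Fin 2 ⊕ Fin 2) ℂ →ₐ[ℂ] MvPolynomial (Fin 3) ℂ)
    (Ideal.span {rename Fin.succ P})

/-- **`W(a, b; P) = Z(θ⁻¹((P̃)))`.** -/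
theorem lineCurveSurface_eq_zeroLocus (P : MvPolynomial (Fin 2) ℂ) :
    lineCurveSurface a b P = zeroLocus ℂ (lcIdeal a b P) := by
  ext w
  rw [mem_zeroLocus_iff]
  constructor
  · rintro ⟨hw1, hwP⟩ p hp
    rw [lcIdeal, Ideal.mem_comap, Ideal.mem_span_singleton] at hp
    obtain ⟨r, hr⟩ := hp
    rw [← eval_lcPt_aeval_lcSubst a b hw1, hr, map_mul, eval_rename]
    have e : (lcPt w ∘ Fin.succ) = fun i => w (Sum.inr i) := funext fun i => by simp [lcPt]
    rw [e, hwP, zero_mul]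
  · intro h
    constructor
    · have hmem : (X (Sum.inl 1) - (C (a : ℂ) * X (Sum.inl 0) + C b) :
          MvPolynomial (Fin 2 ⊕ Fin 2) ℂ) ∈ lcIdeal a b P := by
        rw [lcIdeal, Ideal.mem_comap]
        have e : aeval (lcSubst a b) (X (Sum.inl 1) - (C (a : ℂ) * X (Sum.inl 0) + C b) :
            MvPolynomial (Fin 2 ⊕ Fin 2) ℂ) = 0 := by
          simp [lcSubst]
        rw [e]; exact Ideal.zero_mem _
      have h1 := h _ hmem
      simp only [map_sub, map_add, map_mul, aeval_X, aeval_C, Algebra.algebraMap_self,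
        RingHom.id_apply, sub_eq_zero] at h1
      exact h1
    · have hmem : (rename Sum.inr P : MvPolynomial (Fin 2 ⊕ Fin 2) ℂ) ∈ lcIdeal a b P := by
        have hfg : (lcSubst a b ∘ Sum.inr) = X ∘ Fin.succ := funext fun i => by simp [lcSubst]
        rw [lcIdeal, Ideal.mem_comap, aeval_rename, hfg, ← rename_eq_aeval (R := ℂ) Fin.succ]
        exact Ideal.mem_span_singleton_self _
      have h1 := h _ hmem
      rw [aeval_rename] at h1
      exact h1

variable {P : MvPolynomial (Fin 2) ℂ}

/-- `P̃ = P(y₀, y₁)` stays prime in `ℂ[t, y₀, y₁]`. -/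
theorem prime_rename_succ (hirr : Irreducible P) :
    Prime (rename Fin.succ P : MvPolynomial (Fin 3) ℂ) :=
  prime_rename_of_injective (Fin.succ_injective 2)
    (UniqueFactorizationMonoid.irreducible_iff_prime.1 hirr)

/-- `θ⁻¹((P̃))` is prime. -/
instance lcIdeal_isPrime [Fact (Irreducible P)] : (lcIdeal a b P).IsPrime := by
  have hprime := prime_rename_succ (Fact.out : Irreducible P)
  haveI : (Ideal.span {rename Fin.succ P} : Ideal (MvPolynomial (Fin 3) ℂ)).IsPrime :=
    (Ideal.span_singleton_prime hprime.ne_zero).2 hprime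
  exact Ideal.IsPrime.comap _

/-- **`W(a, b; P)` is an irreducible closed set** for irreducible `P`. (new) -/
theorem isIrreducibleClosed_lineCurveSurface (hirr : Irreducible P) :
    IsIrreducibleClosed ℂ (lineCurveSurface a b P) := by
  haveI : Fact (Irreducible P) := ⟨hirr⟩
  rw [lineCurveSurface_eq_zeroLocus]
  exact isIrreducibleClosed_zeroLocus _

/-- **`dim W(a, b; P) = 2`**: `ℂ[W] ≅ ℂ[t, y₀, y₁]/(P̃)`, a hypersurface ring in three variables.
(new) -/
theorem zariskiDim_lineCurveSurface (hirr : Irreducible P) :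
    zariskiDim ℂ (lineCurveSurface a b P) = (2 : ℕ) := by
  haveI : Fact (Irreducible P) := ⟨hirr⟩
  have hprime := prime_rename_succ hirr
  rw [lineCurveSurface_eq_zeroLocus, zariskiDim_zeroLocus_eq]
  set J : Ideal (MvPolynomial (Fin 3) ℂ) := Ideal.span {rename Fin.succ P} with hJ
  let f : MvPolynomial (Fin 2 ⊕ Fin 2) ℂ →ₐ[ℂ] (MvPolynomial (Fin 3) ℂ ⧸ J) :=
    (Ideal.Quotient.mkₐ ℂ J).comp (aeval (lcSubst a b))
  have hf : Function.Surjective f :=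
    (Ideal.Quotient.mkₐ_surjective ℂ J).comp (lcSubst_surjective a b)
  have hker : RingHom.ker f = lcIdeal a b P := by
    ext p
    simp only [RingHom.mem_ker, lcIdeal, Ideal.mem_comap, f, AlgHom.comp_apply,
      Ideal.Quotient.mkₐ_eq_mk, Ideal.Quotient.eq_zero_iff_mem]
    exact Iff.rfl
  rw [← hker, ringKrullDim_eq_of_ringEquiv (Ideal.quotientKerAlgEquivOfSurjective hf).toRingEquiv,
    hJ, Literature.RingTheory.KrullDimension.ringKrullDim_quotient_span_of_prime_mvPolynomial
      hprime]

/-- **MAIN THEOREM. Zariski density of the exponential points of `{x₁ = a x₀ + b} × Z(P)`**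
(`a ∈ ℝ ∖ ℚ`, `b ∈ ℂ`, `P ∈ ℂ[y₀, y₁]` irreducible with a zero in `(ℂˣ)²`): the solutions of
`P(e^z, e^{az+b}) = 0` give a Zariski dense set of points `(z, az+b, e^z, e^{az+b})` of `W`,
i.e. `I(W ∩ Γ_exp) = I(W)`.  An instance class of Mantova–Masser's open density question; a modest
rung of EAC, NOT Schanuel's conjecture. (new) -/
theorem unprojectedDense_lineCurveSurface {a : ℝ} (ha : Irrational a) (b : ℂ)
    {P : MvPolynomial (Fin 2) ℂ} (hirr : Irreducible P)
    (hW : (lineCurveSurface a b P ∩ torusLocus ℂ 2).Nonempty) :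
    UnprojectedDense (lineCurveSurface a b P) :=
  unprojectedDense_lineCurveSurface_of_isIrreducibleClosed ha b hirr.ne_zero
    (isIrreducibleClosed_lineCurveSurface a b hirr) (by rw [zariskiDim_lineCurveSurface a b hirr])
    hW

/-- The same with the torus point given as a zero `c ∈ (ℂˣ)²` of `P`. (new) -/
theorem unprojectedDense_lineCurveSurface_of_zero {a : ℝ} (ha : Irrational a) (b : ℂ)
    {P : MvPolynomial (Fin 2) ℂ} (hirr : Irreducible P) {c : Fin 2 → ℂ} (h0 : c 0 ≠ 0)
    (h1 : c 1 ≠ 0) (hc : MvPolynomial.eval c P = 0) : UnprojectedDense (lineCurveSurface a b P) :=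
  unprojectedDense_lineCurveSurface ha b hirr
    ((lineCurveSurface_inter_torusLocus_nonempty_iff a b P).2 ⟨c, h0, h1, hc⟩)

/-- **Mantova–Masser's question on the family** (`a ∈ ℝ ∖ ℚ`, `P ≠ 0`): if `W(a, b; P)` is in
the case (dim-π-S-1-free) then its exponential points are Zariski dense. (new) -/
theorem unprojectedDense_lineCurveSurface_of_mmCase {a : ℝ} (ha : Irrational a) (b : ℂ)
    {P : MvPolynomial (Fin 2) ℂ} (hP : P ≠ 0) (h : MMCaseDimPiOneFree (lineCurveSurface a b P)) :
    UnprojectedDense (lineCurveSurface a b P) :=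
  unprojectedDense_lineCurveSurface_of_isIrreducibleClosed ha b hP h.1 (le_of_eq h.2.2.1) h.2.1

end Certificate

end Summit.Schanuel.Schanuel.Theorems
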